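import Literature.NumberTheory.Automorphic.MixedSpaceUnitsHaar
import Literature.NumberTheory.Automorphic.RankinSelbergTowerFiniteness
import Literature.NumberTheory.Automorphic.ArchimedeanDetIntegral
import Mathlib.Analysis.SpecialFunctions.JapaneseBracket
import HarnessLib

/-!
# An exponential moment of the Haar measure of `K_∞ˣ`

Topic `NumberTheory/Automorphic`; namespace `Literature.NumberTheory.Automorphic`. Theorems only. The
archimedean integral in the second torus coordinate of the bad-place Rankin–Selberg torus integral of
`GL_2` at `s = 1` (plumbing of the Kirillov `L²`-bound; the `n ≤ 2` case of the named fact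
`JacquetShalika1981_partialPairL_pole_of_eq_conj`): with the Schwartz factor bounded by
`exp(-‖x‖/√2)` (`TorusIntegrandGL2PhiBound`) and the torus weight `|det|² = N(x)²`,

  `∫_{K_∞ˣ} exp(-c ‖x‖) N(x)² d^×x < ∞`   (`lintegral_exp_neg_mul_norm_sq_lt_top`, `c > 0`)

(`d^×x = dx / N(x)`, `N(x) ≤ ‖x‖^{[K:ℚ]}`, `exp(-c t) ≤ C_k (1 + t)^{-k}` and the Japanese bracket
`finite_integral_one_add_norm`). [folklore]

## References

* J. W. S. Cassels, A. Fröhlich (eds.), *Algebraic Number Theory* (1967), Ch. XV (Tate), §2.2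
  [CasselsFrohlichANT1967].
-/

noncomputable section

open scoped Classical ENNReal
open NumberField NumberField.mixedEmbedding NumberField.InfinitePlace MeasureTheory
open Literature.MeasureTheory.Group

namespace Literature.NumberTheory.Automorphic

variable (K : Type*) [Field K] [NumberField K]

attribute [local instance] Units.borelSpace_of_isOpenEmbedding hasSummableGeomSeries_of_finiteDimensional

/-- `exp(-c t) ≤ e k! (min 1 c)^{-k} (1 + t)^{-k}` for `t ≥ 0`, `c > 0`. [folklore] -/
theorem exp_neg_mul_le_mul_one_add_rpow_neg {c : ℝ} (hc : 0 < c) (k : ℕ) {t : ℝ} (ht : 0 ≤ t) :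
    Real.exp (-(c * t)) ≤ Real.exp 1 * k.factorial * (min 1 c)⁻¹ ^ k * (1 + t) ^ (-(k : ℝ)) := by
  have hm : 0 < min 1 c := lt_min one_pos hc
  have h1 := exp_neg_le_mul_one_add_rpow_neg k (mul_nonneg hc.le ht)
  have hct : min 1 c * (1 + t) ≤ 1 + c * t := by
    have := min_le_left 1 c; have := min_le_right 1 c
    nlinarith
  have h2 : (1 + c * t) ^ (-(k : ℝ)) ≤ (min 1 c)⁻¹ ^ k * (1 + t) ^ (-(k : ℝ)) := by
    rw [Real.rpow_neg (by positivity), Real.rpow_neg (by positivity), Real.rpow_natCast, Real.rpow_natCast, ← inv_pow,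
      ← inv_pow, ← mul_pow]
    refine pow_le_pow_left₀ (by positivity) ?_ k
    rw [← mul_inv]
    exact inv_anti₀ (mul_pos hm (by positivity)) hct
  calc Real.exp (-(c * t)) ≤ Real.exp 1 * k.factorial * (1 + c * t) ^ (-(k : ℝ)) := h1
    _ ≤ Real.exp 1 * k.factorial * ((min 1 c)⁻¹ ^ k * (1 + t) ^ (-(k : ℝ))) := mul_le_mul_of_nonneg_left h2 (by positivity)
    _ = _ := by ring

/-- **`∫_{K_∞ˣ} exp(-c‖x‖) N(x)² d^×x < ∞`** for `c > 0`. [cite: CasselsFrohlichANT1967, Ch. XV (Tate), §2.2] -/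
theorem lintegral_exp_neg_mul_norm_sq_lt_top {c : ℝ} (hc : 0 < c) :
    ∫⁻ u, ENNReal.ofReal (Real.exp (-(c * ‖(u : mixedSpace K)‖)) * mixedEmbedding.norm (u : mixedSpace K) ^ 2) ∂mixedUnitsHaar K < ⊤ := by
  set g : mixedSpace K → ℝ≥0∞ := fun x => ENNReal.ofReal (Real.exp (-(c * ‖x‖)) * mixedEmbedding.norm x ^ 2) with hg
  have hNc : Continuous (mixedEmbedding.norm : mixedSpace K → ℝ) := by
    have : Continuous fun x : mixedSpace K => ∏ w : InfinitePlace K, normAtPlace w x ^ mult w :=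
      continuous_finsetProd _ fun w _ => (continuous_normAtPlace w).pow _
    convert this using 1
    funext x
    exact mixedEmbedding.norm_apply x
  have hgm : Measurable g :=
    ENNReal.measurable_ofReal.comp (((Real.continuous_exp.comp (continuous_const.mul continuous_norm).neg).mul (hNc.pow 2)).measurable)
  have h1 : ∫⁻ u, g (u : mixedSpace K) ∂mixedUnitsHaar K =
      ∫⁻ x in {x : mixedSpace K | IsUnit x}, g x * (ENNReal.ofReal (mixedEmbedding.norm x))⁻¹ ∂volume :=
    lintegral_mixedUnitsHaar K hgm
  show ∫⁻ u, g (u : mixedSpace K) ∂mixedUnitsHaar K < ⊤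
  rw [h1]
  -- on units, `g N⁻¹ = exp(-c‖x‖) N(x)`; bound by `C (1 + ‖x‖)^{-r}`
  set D : ℕ := Module.finrank ℚ K with hD
  set d : ℕ := Module.finrank ℝ (mixedSpace K) with hd
  set k : ℕ := D + d + 1 with hk
  set C : ℝ := Real.exp 1 * k.factorial * (min 1 c)⁻¹ ^ k with hC
  have hCpos : 0 < C := by have := lt_min one_pos hc; positivity
  have hbound : ∀ x : mixedSpace K, g x * (ENNReal.ofReal (mixedEmbedding.norm x))⁻¹ ≤
      ENNReal.ofReal (C * (1 + ‖x‖) ^ (-((d : ℝ) + 1))) := by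
    intro x
    by_cases hN : mixedEmbedding.norm x = 0
    · rw [hg]; simp [hN]
    have hNpos : 0 < mixedEmbedding.norm x := lt_of_le_of_ne (mixedEmbedding.norm_nonneg x) (Ne.symm hN)
    have e : g x * (ENNReal.ofReal (mixedEmbedding.norm x))⁻¹ = ENNReal.ofReal (Real.exp (-(c * ‖x‖)) * mixedEmbedding.norm x) := by
      rw [hg]
      simp only
      rw [pow_two, ← mul_assoc, ENNReal.ofReal_mul (by positivity), mul_assoc, ENNReal.mul_inv_cancel
        ((ENNReal.ofReal_pos.2 hNpos).ne') ENNReal.ofReal_ne_top, mul_one]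
    rw [e]
    refine ENNReal.ofReal_le_ofReal ?_
    have hx0 : 0 ≤ ‖x‖ := norm_nonneg x
    have hexp := exp_neg_mul_le_mul_one_add_rpow_neg hc k hx0
    have hNle : mixedEmbedding.norm x ≤ (1 + ‖x‖) ^ (D : ℝ) := by
      rw [Real.rpow_natCast]
      exact (mixedEmbedding_norm_le_norm_pow (K := K) x).trans (pow_le_pow_left₀ hx0 (by linarith) D)
    calc Real.exp (-(c * ‖x‖)) * mixedEmbedding.norm x ≤ (C * (1 + ‖x‖) ^ (-(k : ℝ))) * (1 + ‖x‖) ^ (D : ℝ) :=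
          mul_le_mul hexp hNle hNpos.le (by positivity)
      _ = C * (1 + ‖x‖) ^ (-((d : ℝ) + 1)) := by
          rw [mul_assoc, ← Real.rpow_add (by positivity)]
          congr 2
          rw [hk]; push_cast; ring
  calc ∫⁻ x in {x : mixedSpace K | IsUnit x}, g x * (ENNReal.ofReal (mixedEmbedding.norm x))⁻¹ ∂volume
      ≤ ∫⁻ x, g x * (ENNReal.ofReal (mixedEmbedding.norm x))⁻¹ ∂volume := setLIntegral_le_lintegral _ _
    _ ≤ ∫⁻ x, ENNReal.ofReal (C * (1 + ‖x‖) ^ (-((d : ℝ) + 1))) ∂volume := lintegral_mono hbound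
    _ = ENNReal.ofReal C * ∫⁻ x : mixedSpace K, ENNReal.ofReal ((1 + ‖x‖) ^ (-((d : ℝ) + 1))) ∂volume := by
        rw [← lintegral_const_mul' _ _ ENNReal.ofReal_ne_top]
        refine lintegral_congr fun x => ?_
        rw [ENNReal.ofReal_mul hCpos.le]
    _ < ⊤ := ENNReal.mul_lt_top ENNReal.ofReal_lt_top (finite_integral_one_add_norm (by rw [hd]; linarith))

end Literature.NumberTheory.Automorphic
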